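import Literature.NumberTheory.Sieve.RoughNumbersBuchstabIdentity
import HarnessLib

/-!
# Rough numbers sorted by `Ω`: the `Ω`-refined Buchstab identity and the elementary cell counts

Topic `Literature/NumberTheory/Sieve`, next to `RoughNumbersBuchstabIdentity.lean`. Everything
here is PROVED (no definitions, no named facts). The `N`-rough numbers
`roughIcc N X = {1 ≤ b ≤ X : p ∣ b ⇒ p ≥ N}` (`SmoothRoughDecomposition.lean`) are sorted into the
**`Ω`-cells** `{b ∈ roughIcc N X : Ω(b) = j}`, written `(roughIcc N X).filter (fun b => Ω b = j)`
with `Ω = ArithmeticFunction.cardFactors` (no new definition): the finite sets counted by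
Alladi's `Φ_j(x, y) = #{n ≤ x : P⁻(n) ≥ y, Ω(n) = j}` (K. Alladi, *The distribution of `ν(n)` in
the sieve of Eratosthenes*, 1982: `#{n ≤ x : P⁻(n) > x^{1/u}, Ω(n) = j} ∼ I_j(u) x / log x`, the
densities `I_j` being `roughCellDensity j` of `RoughCellDensity.lean`). This file supplies the
COMBINATORIAL inputs of that asymptotic: Buchstab's identity (`card_roughIcc_eq_card_add_sum`)
with the `Ω`-bookkeeping, and the trivial cells.

* `card_roughIcc_filter_cardFactors_eq_add_sum` — the **`Ω`-refined Buchstab identity**: for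
  `N ≤ M`,
  `#{b ∈ roughIcc N X : Ω b = j+1} = #{b ∈ roughIcc M X : Ω b = j+1}`
  `    + ∑_{N ≤ p < M, p prime} #{c ∈ roughIcc p (X / p) : Ω c = j}`
  (sorting the `b ∉ roughIcc M X` by their least prime factor `p = P⁻(b) ∈ [N, M)` and writing
  `b = p c`: `c` is `p`-rough, `c ≤ X / p`, and `Ω(b) = 1 + Ω(c)`; the fibre bijection is
  `card_filter_minFac_filter_cardFactors_eq`);
* `roughIcc_filter_cardFactors_one`, `card_roughIcc_filter_cardFactors_one` — the cell `Ω = 1` is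
  the set of primes in `[N, X]`; `roughIcc_filter_cardFactors_zero` — the cell `Ω = 0` is `{1}`;
* `card_roughIcc_filter_cardFactors_le_one` — for `X ≤ N²` a cell with `Ω = j ≥ 2` has at most
  one element (necessarily `N² = X`);
* `card_roughIcc_filter_cardFactors_le` — the trivial bound `≤ X`;
* `pow_cardFactors_le_of_mem_roughIcc` — `N ^ Ω(b) ≤ b` for `b ∈ roughIcc N X`, whence
  `roughIcc_filter_cardFactors_eq_empty`: the cell `Ω = j` is empty as soon as `X < N ^ j`.

## References

* K. Alladi, *The distribution of `ν(n)` in the sieve of Eratosthenes*, Quart. J. Math. Oxford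
  (2) 33 (1982) 129–148 (the Buchstab iteration sorted by the number of prime factors).
  [Alladi1982]
* J. D. Lichtman, *A modification of the linear sieve, and the count of twin primes*,
  arXiv:2109.02851, §6 (proof of Proposition 6.3, "By the Buchstab identity").
  [Lichtman2025LinearSieve]
* G. Tenenbaum, *Introduction to analytic and probabilistic number theory*, 3rd ed., AMS (2015),
  III.6. [Tenenbaum2015]
-/

open Finset ArithmeticFunction
open scoped ArithmeticFunction.Omega

namespace Literature.NumberTheory.Sieve

/-! ### The `Ω`-refined Buchstab identity -/

/-- The fibre of the least-prime-factor map on an `Ω`-cell over a prime `p ∈ [N, M)`: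
`b ↦ b / p` is a bijection from `{b ∈ roughIcc N X ∖ roughIcc M X : Ω b = j + 1, P⁻(b) = p}`
onto `{c ∈ roughIcc p (X / p) : Ω c = j}` (inverse `c ↦ p c`; `Ω(p c) = 1 + Ω(c)`).
[folklore] -/
theorem card_filter_minFac_filter_cardFactors_eq {N M X p j : ℕ} (hp : p.Prime) (hNp : N ≤ p)
    (hpM : p < M) :
    (((roughIcc N X \ roughIcc M X).filter (fun b => Ω b = j + 1)).filter
        (fun b => b.minFac = p)).card =
      ((roughIcc p (X / p)).filter (fun b => Ω b = j)).card := by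
  refine Finset.card_bij' (fun b _ => b / p) (fun c _ => p * c) ?_ ?_ ?_ ?_
  · -- `b / p ∈ roughIcc p (X / p)` and `Ω (b / p) = j`
    intro b hb
    rw [mem_filter, mem_filter] at hb
    obtain ⟨⟨hbs, hbΩ⟩, hbm⟩ := hb
    have hbN := (mem_sdiff.mp hbs).1
    rw [mem_roughIcc] at hbN
    have hpb : p ∣ b := hbm ▸ Nat.minFac_dvd b
    have hc0 : 0 < b / p := Nat.div_pos (Nat.le_of_dvd hbN.1.1 hpb) hp.pos
    rw [mem_filter, mem_roughIcc]
    refine ⟨⟨⟨hc0, Nat.div_le_div_right hbN.1.2⟩, fun q hq hqc => ?_⟩, ?_⟩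
    · have hqb : q ∣ b := hqc.trans (Nat.div_dvd_of_dvd hpb)
      exact hbm ▸ Nat.minFac_le_of_dvd hq.two_le hqb
    · have h := cardFactors_mul hp.ne_zero hc0.ne'
      rw [Nat.mul_div_cancel' hpb, cardFactors_apply_prime hp] at h
      omega
  · -- `p * c` lies in the fibre
    intro c hc
    rw [mem_filter, mem_roughIcc] at hc
    obtain ⟨⟨⟨hc1, hcX⟩, hcr⟩, hcΩ⟩ := hc
    have hpc_fac : ∀ q : ℕ, q.Prime → q ∣ p * c → p ≤ q := by
      intro q hq hqpc
      rcases (Nat.Prime.dvd_mul hq).mp hqpc with h | h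
      · exact ((Nat.prime_dvd_prime_iff_eq hq hp).mp h).ge
      · exact hcr q hq h
    have hmin : (p * c).minFac = p := by
      apply le_antisymm
      · exact Nat.minFac_le_of_dvd hp.two_le (dvd_mul_right p c)
      · have h1 : p * c ≠ 1 := by
          intro h; exact hp.one_lt.ne' (Nat.eq_one_of_mul_eq_one_right h)
        exact hpc_fac _ (Nat.minFac_prime h1) (Nat.minFac_dvd _)
    rw [mem_filter, mem_filter, mem_sdiff, mem_roughIcc, mem_roughIcc]
    refine ⟨⟨⟨⟨⟨?_, ?_⟩, fun q hq hqpc => hNp.trans (hpc_fac q hq hqpc)⟩, ?_⟩, ?_⟩, hmin⟩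
    · exact Nat.mul_pos hp.pos hc1
    · exact (Nat.mul_le_mul_left p hcX).trans (Nat.mul_div_le X p)
    · rintro ⟨-, hM⟩
      exact (hM p hp (dvd_mul_right p c)).not_gt hpM
    · rw [cardFactors_mul hp.ne_zero (Nat.one_le_iff_ne_zero.mp hc1), cardFactors_apply_prime hp,
        hcΩ, add_comm]
  · -- left inverse
    intro b hb
    rw [mem_filter, mem_filter] at hb
    have hpb : p ∣ b := hb.2 ▸ Nat.minFac_dvd b
    exact Nat.mul_div_cancel' hpb
  · -- right inverse
    intro c _
    exact Nat.mul_div_cancel_left c hp.pos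

/-- **Buchstab's identity sorted by `Ω`** (Alladi's recursion for `Φ_j(x, y)`): for `N ≤ M`,
`#{b ∈ roughIcc N X : Ω b = j + 1} = #{b ∈ roughIcc M X : Ω b = j + 1}`
`    + ∑_{p prime, N ≤ p < M} #{c ∈ roughIcc p (X / p) : Ω c = j}`:
an `N`-rough `b` that is not `M`-rough has least prime factor `p ∈ [N, M)`, and `b = p c` with
`c` `p`-rough, `c ≤ X / p`, `Ω(c) = Ω(b) - 1`. Summed over `j` it is Buchstab's identity
`card_roughIcc_eq_card_add_sum` (Lichtman, proof of Prop. 6.3, "By the Buchstab identity").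
[cite: Alladi1982, Buchstab iteration for the cells nu(n) = j (sieve of Eratosthenes)] -/
theorem card_roughIcc_filter_cardFactors_eq_add_sum {N M : ℕ} (hNM : N ≤ M) (X j : ℕ) :
    ((roughIcc N X).filter (fun b => Ω b = j + 1)).card =
      ((roughIcc M X).filter (fun b => Ω b = j + 1)).card +
        ∑ p ∈ (Ico N M).filter Nat.Prime,
          ((roughIcc p (X / p)).filter (fun b => Ω b = j)).card := by
  have hsub : (roughIcc M X).filter (fun b => Ω b = j + 1) ⊆
      (roughIcc N X).filter (fun b => Ω b = j + 1) :=
    filter_subset_filter _ (roughIcc_subset_of_le hNM X)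
  have hsdiff : (roughIcc N X).filter (fun b => Ω b = j + 1) \
      (roughIcc M X).filter (fun b => Ω b = j + 1) =
        (roughIcc N X \ roughIcc M X).filter (fun b => Ω b = j + 1) := by
    ext b
    simp only [mem_sdiff, mem_filter]
    tauto
  have hsd : ((roughIcc N X \ roughIcc M X).filter (fun b => Ω b = j + 1)).card =
      ∑ p ∈ (Ico N M).filter Nat.Prime,
        ((roughIcc p (X / p)).filter (fun b => Ω b = j)).card := by
    rw [card_eq_sum_card_fiberwise (f := Nat.minFac) (t := (Ico N M).filter Nat.Prime)]
    · refine sum_congr rfl fun p hp => ?_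
      rw [mem_filter, mem_Ico] at hp
      exact card_filter_minFac_filter_cardFactors_eq hp.2 hp.1.1 hp.1.2
    · intro b hb
      obtain ⟨-, hpr, hN, hM⟩ := minFac_mem_of_mem_sdiff (mem_filter.mp hb).1
      exact mem_filter.mpr ⟨mem_Ico.mpr ⟨hN, hM⟩, hpr⟩
  rw [← hsd, ← hsdiff, ← card_union_of_disjoint disjoint_sdiff, union_sdiff_of_subset hsub]

/-! ### The cells `Ω = 0` and `Ω = 1` -/

/-- The cell `Ω = 1` of the `N`-rough numbers up to `X` is the set of primes in `[N, X]`
(`Ω b = 1 ↔ b` prime, and a prime is `N`-rough iff it is `≥ N`). [folklore] -/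
theorem roughIcc_filter_cardFactors_one (N X : ℕ) :
    (roughIcc N X).filter (fun b => Ω b = 1) = (Icc N X).filter Nat.Prime := by
  ext b
  simp only [mem_filter, mem_Icc, cardFactors_eq_one_iff_prime]
  constructor
  · rintro ⟨hb, hbp⟩
    have hb' := mem_roughIcc.mp hb
    exact ⟨⟨hb'.2 b hbp dvd_rfl, hb'.1.2⟩, hbp⟩
  · rintro ⟨⟨hNb, hbX⟩, hbp⟩
    exact ⟨prime_mem_roughIcc hbp hNb hbX, hbp⟩

/-- `#{b ∈ roughIcc N X : Ω b = 1} = #{p prime : N ≤ p ≤ X}` (no hypothesis on `N`: for `N ≤ 1`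
both sides count all primes `≤ X`). [folklore] -/
theorem card_roughIcc_filter_cardFactors_one (N X : ℕ) :
    ((roughIcc N X).filter (fun b => Ω b = 1)).card = ((Icc N X).filter Nat.Prime).card := by
  rw [roughIcc_filter_cardFactors_one]

/-- The cell `Ω = 0` of the `N`-rough numbers up to `X ≥ 1` is `{1}`. [folklore] -/
theorem roughIcc_filter_cardFactors_zero (N : ℕ) {X : ℕ} (hX : 1 ≤ X) :
    (roughIcc N X).filter (fun b => Ω b = 0) = {1} := by
  ext b
  rw [mem_filter, mem_singleton, cardFactors_eq_zero_iff_eq_zero_or_one]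
  constructor
  · rintro ⟨hb, hb0 | hb1⟩
    · exact absurd (mem_roughIcc.mp hb).1.1 (by omega)
    · exact hb1
  · rintro rfl
    exact ⟨one_mem_roughIcc hX, Or.inr rfl⟩

/-! ### The count for `X ≤ N²` and the trivial bounds -/

/-- For `X ≤ N²` an `Ω`-cell with `Ω = j ≥ 2` of the `N`-rough numbers up to `X` has at most one
element: such a `b` is neither `1` nor prime, so `N² ≤ b ≤ X ≤ N²` (`sq_le_of_mem_roughIcc`).
[folklore] -/
theorem card_roughIcc_filter_cardFactors_le_one {N X j : ℕ} (hXN : X ≤ N * N) (hj : 2 ≤ j) :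
    ((roughIcc N X).filter (fun b => Ω b = j)).card ≤ 1 := by
  have key : ∀ c ∈ (roughIcc N X).filter (fun b => Ω b = j), c = N * N := by
    intro c hc
    rw [mem_filter] at hc
    obtain ⟨hc, hcΩ⟩ := hc
    have hc1 : c ≠ 1 := by
      rintro rfl
      rw [cardFactors_one] at hcΩ
      omega
    have hcp : ¬c.Prime := by
      intro h
      rw [cardFactors_apply_prime h] at hcΩ
      omega
    have h1 := sq_le_of_mem_roughIcc hc hc1 hcp
    have h2 := (mem_roughIcc.mp hc).1.2
    omega
  rw [Finset.card_le_one]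
  intro a ha b hb
  rw [key a ha, key b hb]

/-- The trivial bound `#{b ∈ roughIcc N X : Ω b = j} ≤ X`. [folklore] -/
theorem card_roughIcc_filter_cardFactors_le (N X j : ℕ) :
    ((roughIcc N X).filter (fun b => Ω b = j)).card ≤ X :=
  calc ((roughIcc N X).filter (fun b => Ω b = j)).card ≤ (Icc 1 X).card :=
        card_le_card ((filter_subset _ _).trans (roughIcc_subset_Icc N X))
    _ = X := by simp

/-- `N ^ Ω(b) ≤ b` for an `N`-rough `b ≥ 1`: `b` is the product of its `Ω(b)` prime factors, each
`≥ N`. [folklore] -/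
theorem pow_cardFactors_le_of_mem_roughIcc {N X b : ℕ} (hb : b ∈ roughIcc N X) : N ^ Ω b ≤ b := by
  have hb' := mem_roughIcc.mp hb
  have hb0 : b ≠ 0 := Nat.one_le_iff_ne_zero.mp hb'.1.1
  rw [cardFactors_apply]
  conv_rhs => rw [← Nat.prod_primeFactorsList hb0]
  exact List.pow_card_le_prod _ _ fun p hp =>
    hb'.2 p (Nat.prime_of_mem_primeFactorsList hp) (Nat.dvd_of_mem_primeFactorsList hp)

/-- The cell `Ω = j` of the `N`-rough numbers up to `X` is empty as soon as `X < N ^ j`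
(`N ^ j = N ^ Ω(b) ≤ b ≤ X`). [folklore] -/
theorem roughIcc_filter_cardFactors_eq_empty {N X j : ℕ} (h : X < N ^ j) :
    (roughIcc N X).filter (fun b => Ω b = j) = ∅ := by
  rw [Finset.filter_eq_empty_iff]
  intro b hb hbΩ
  have h1 := pow_cardFactors_le_of_mem_roughIcc hb
  rw [hbΩ] at h1
  exact ((h1.trans (mem_roughIcc.mp hb).1.2).trans_lt h).false

end Literature.NumberTheory.Sieve
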